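import Mathlib
import Summits.NavierStokesRegularity.NavierStokesRegularity.Theses.SubcriticalEnvelope
import Summits.NavierStokesRegularity.NavierStokesRegularity.Theorems.OrthantWakeTwinSideBranch
import Summits.NavierStokesRegularity.NavierStokesRegularity.Theorems.SubOnsagerCeilingSideBranchWitness
import Summits.NavierStokesRegularity.NavierStokesRegularity.Theorems.SubcriticalEnvelopeForwardSourceTailEnvelopeRedressing
import Literature.Analysis.FluidPDE.TaoCascadeODEProofs
import HarnessLib

/-!
# `SubcriticalEnvelope.ForwardSourceTailEnvelope` (stmt-NavierStokesRegularity-26373, crux A⁺) —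
the EXACT TWIN EMBEDDING of `α_SB` and the reduction «A⁺ AS TYPED ⇒ the total-energy envelope A‴
on the side-branch dead-end table» (helper file, `--supports`)

Context (prover-ns-ow-p1-g4's structural negative, 2026-08-28; critic idea-crit-3 RE-RULE
08:35:05Z; KEY-NS #103/#105).  `ForwardSourceTailEnvelope` quantifies, for EVERY table of `E₂(R)`,
`∃ S : Finset (Fin 4)` containing all SYNTACTIC forward sources (`i ∉ S → α i j l (0,0,1) = 0`) and
asserts a `ν`-uniform window-wise subcritical envelope of the `S`-partial tail energies.  On the twin
side-branch table `twinSideBranchTable ∈ E₂(17)` (`Theorems/OrthantWakeDefs.lean`,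
`…TwinSideBranch.lean`: the dead-end table `α_SB = SubOnsagerCeiling.sideBranchTable` with its pocket
feed split `3/25 : 4/25` into twins and a differential feed `(4x₂ − 3x₃)²/16 → x₀′`) every
component is a syntactic source, so `S = univ` is forced, while the table carries every `α_SB`
trajectory exactly through `twinEmbed : (X₀, X₁, X₂, X₃) ↦ (X₀, X₁, (3/5)X₂, (4/5)X₂)`.

This file proves the EXACT EMBEDDING and composes it with the generic re-dressing transfer
(`…ForwardSourceTailEnvelopeRedressing.lean`):

* `twinEmbed_eq_matrix` — `twinEmbed` is the linear mode map of the matrix `L_SB` with rows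
  `(1,0,0,0)`, `(0,1,0,0)`, `(0,0,3/5,0)`, `(0,0,4/5,0)`;
* `twinEmbed_quadTerm` — the intertwining identity
  `quadTerm ε₀ twinSideBranchTable (twinEmbed Y) i k t = twinMix (quadTerm ε₀ sideBranchTable Y · k t) i`
  for EVERY amplitude family `Y` (pure algebra: the split back-reactions on `x₁` re-sum to `1/5`,
  the differential feed and its back-reactions vanish identically on `4x̃₂ − 3x̃₃ ≡ 0`), and its
  matrix form `twinSideBranchTable_intertwine`;
* `twinMix_energy_le` — the shell energy of `v` is the shell energy of `twinMix v` plus `½v₃²`;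
* `sideBranchTable_target_three` — component `3` of `α_SB` is DEAD (no structure constant targets it);
* `sideBranchTable_diagonalFeed` / `twinSideBranchTable_not_diagonalFeed` — the class clause of
  the repair («diagonal inter-shell feeds», KEY-NS #105 (iii)) keeps `α_SB` and excludes the twin;
* `twinEmbed_honest` — hence `twinEmbed` maps honest `ν`-viscous `α_SB`-solutions on `[0,s]` from
  `X₀` to honest `ν`-viscous `twinSideBranchTable`-solutions from `twinMix X₀` (all five clauses);
* `forwardSourceTailEnvelope_imp_totalEnvelope_sideBranch` — **A⁺ as typed implies, below its own
  threshold `εs(17)`, VERBATIM the body of the aside A‴ = `ViscousTailEnvelope` (stmt-26128) at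
  `α := sideBranchTable`**: a `ν`-uniform window-wise subcritical envelope of the TOTAL tail energy
  of every honest viscous `α_SB`-solution from every one-shell datum — the statement the cluster's
  numerics report supercritical on `α_SB` (parked pocket energy `≍ E₀(1+ε₀)^{-5n/9}`,
  `Cruxes/OrthantTailCeiling/REFUTATION-EVIDENCE.md`, kit j302483).  So a certified lower bound for
  ONE `α_SB` trajectory would refute 26373 as typed in the kernel; until then this is the exact
  kernel form of «misstated-CLASS», and the class clause of the repair (diagonal inter-shell feeds,
  KEY-NS #105 (iii)) is precisely what excludes `twinSideBranchTable` (`α_{230,(0,0,1)} = −3/4`).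

HONEST FRAMING: algebra and bookkeeping about Tao-type MODEL lattice ODEs (route
SubcriticalEnvelope, rung TL-M2Break).  `ForwardSourceTailEnvelope` is neither proved nor refuted
here; nothing in this file is a statement about the Navier–Stokes equations; NS regularity is NOT
advanced by it.
-/

noncomputable section

-- the sub-problem namespace `NavierStokesRegularity.NavierStokesRegularity` is the tree's layout (D-0017)
set_option linter.dupNamespace false

namespace Summit.NavierStokesRegularity.NavierStokesRegularity.Theorems

open Set
open Literature.Analysis.FluidPDE.TaoCascade
open Summit.NavierStokesRegularity.NavierStokesRegularity.Theorems.SubOnsagerCeiling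
open Summit.NavierStokesRegularity.NavierStokesRegularity.Theses

/-! ## The embedding as a linear mode map -/

/-- `twinEmbed` is the linear mode map `X̃_{i,k} = Σ_j (L_SB)_{ij} X_{j,k}` of the matrix `L_SB`
with rows `(1,0,0,0)`, `(0,1,0,0)`, `(0,0,3/5,0)`, `(0,0,4/5,0)`. MODEL lattice bookkeeping.
[this file] -/
theorem twinEmbed_eq_matrix (Y : Fin 4 → ℤ → ℝ → ℝ) :
    twinEmbed Y = fun i k t => ∑ j,
      (![![1, 0, 0, 0], ![0, 1, 0, 0], ![0, 0, 3 / 5, 0], ![0, 0, 4 / 5, 0]] :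
        Fin 4 → Fin 4 → ℝ) i j * Y j k t := by
  funext i k t
  fin_cases i <;> simp [twinEmbed, twinMix, Fin.sum_univ_four]

/-- The twin datum: `twinEmbed Y i k 0` is the one-shell datum `twinMix X₀` whenever `Y` starts from
the one-shell datum `X₀`; stated as the matrix identity `twinMix v i = Σ_j (L_SB)_{ij} v_j`.
MODEL lattice bookkeeping. [this file] -/
theorem twinMix_eq_matrix (v : Fin 4 → ℝ) (i : Fin 4) :
    twinMix v i = ∑ j,
      (![![1, 0, 0, 0], ![0, 1, 0, 0], ![0, 0, 3 / 5, 0], ![0, 0, 4 / 5, 0]] :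
        Fin 4 → Fin 4 → ℝ) i j * v j := by
  fin_cases i <;> simp [twinMix, Fin.sum_univ_four]

/-! ## The exact embedding: the cascade nonlinearity intertwines -/

/-- **EXACT EMBEDDING (matrix form).** For EVERY amplitude family `Y`, the cascade nonlinearity of
`twinSideBranchTable` along `L_SB·Y` is `L_SB` applied to the cascade nonlinearity of `α_SB` along
`Y`: component `0` — chain + pump back-reaction, the differential feed `(x̃₂ − ¾x̃₃)²` vanishes;
component `1` — pump feed, twin back-reactions `(3/25)(3/5) + (4/25)(4/5) = 1/5`; components `2`,
`3` — `3/5` resp. `4/5` of the pocket feed `(1/5)Λx₁²`, differential back-reactions cancel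
(`−½·3/5 + ⅜·4/5 = 0`, `−(9/16)·4/5 + ¾·3/5 = 0`).  Pure polynomial algebra. [this file] -/
theorem twinSideBranchTable_intertwine (ε₀ : ℝ) (Y : Fin 4 → ℤ → ℝ → ℝ) (i : Fin 4) (k : ℤ)
    (t : ℝ) :
    quadTerm ε₀ twinSideBranchTable
        (fun i k t => ∑ j, (![![1, 0, 0, 0], ![0, 1, 0, 0], ![0, 0, 3 / 5, 0], ![0, 0, 4 / 5, 0]] :
          Fin 4 → Fin 4 → ℝ) i j * Y j k t) i k t =
      ∑ j, (![![1, 0, 0, 0], ![0, 1, 0, 0], ![0, 0, 3 / 5, 0], ![0, 0, 4 / 5, 0]] :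
          Fin 4 → Fin 4 → ℝ) i j * quadTerm ε₀ sideBranchTable Y j k t := by
  fin_cases i <;>
    simp [quadTerm, sum_shiftSet, Fin.sum_univ_four, twinSideBranchTable_feed,
      twinSideBranchTable_up1, twinSideBranchTable_up2, twinSideBranchTable_inshell,
      sideBranchTable_feed, sideBranchTable_up1, sideBranchTable_up2, sideBranchTable_inshell] <;>
    ring

/-- **EXACT EMBEDDING.** For EVERY amplitude family `Y`:
`quadTerm ε₀ twinSideBranchTable (twinEmbed Y) i k t = twinMix (j ↦ quadTerm ε₀ sideBranchTable Y j k t) i`,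
i.e. `twinEmbed` conjugates the `α_SB` cascade vector field into the `twin-α_SB` one (the viscous
damping is diagonal and commutes trivially).  MODEL lattice algebra. [this file] -/
theorem twinEmbed_quadTerm (ε₀ : ℝ) (Y : Fin 4 → ℤ → ℝ → ℝ) (i : Fin 4) (k : ℤ) (t : ℝ) :
    quadTerm ε₀ twinSideBranchTable (twinEmbed Y) i k t =
      twinMix (fun j => quadTerm ε₀ sideBranchTable Y j k t) i := by
  rw [twinEmbed_eq_matrix, twinSideBranchTable_intertwine, twinMix_eq_matrix]

/-! ## Shell energies and the dead component of `α_SB` -/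

/-- **Shell energy under the twin mixing**: `Σ_i ½v_i² ≤ Σ_i ½(L_SB v)_i² + ½v₃²` (in fact an
equality, `(3/5)² + (4/5)² = 1`), in the shape consumed by `envelope_pullback_of_redress` with
`S = univ`, `D = {3}`. [this file] -/
theorem twinMix_energy_le (v : Fin 4 → ℝ) :
    ∑ i, (1 / 2 : ℝ) * v i ^ 2 ≤
      ∑ i ∈ (Finset.univ : Finset (Fin 4)), (1 / 2 : ℝ) *
          (∑ j, (![![1, 0, 0, 0], ![0, 1, 0, 0], ![0, 0, 3 / 5, 0], ![0, 0, 4 / 5, 0]] :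
            Fin 4 → Fin 4 → ℝ) i j * v j) ^ 2 +
        ∑ c ∈ ({3} : Finset (Fin 4)), (1 / 2 : ℝ) * v c ^ 2 := by
  apply le_of_eq
  simp [Fin.sum_univ_four]
  ring

/-- **Shell energy is preserved by the embedding up to the dropped component**:
`Σ_i ½(twinEmbed X)_{i,k}(t)² + ½X_{3,k}(t)² = Σ_i ½X_{i,k}(t)²`. MODEL lattice algebra. [this file] -/
theorem twinEmbed_energy (X : Fin 4 → ℤ → ℝ → ℝ) (k : ℤ) (t : ℝ) :
    ∑ i, (1 / 2 : ℝ) * twinEmbed X i k t ^ 2 + (1 / 2 : ℝ) * X 3 k t ^ 2 =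
      ∑ i, (1 / 2 : ℝ) * X i k t ^ 2 := by
  simp [Fin.sum_univ_four, twinEmbed, twinMix]
  ring

/-- **Component `3` of `α_SB` is dead**: no structure constant of `sideBranchTable` targets it, on
any shift of Tao's shift set. [this file] -/
theorem sideBranchTable_target_three (i₁ i₂ : Fin 4) :
    ∀ μ ∈ shiftSet, sideBranchTable i₁ i₂ 3 μ = 0 := by
  intro μ hμ
  rw [mem_shiftSet_iff] at hμ
  rcases hμ with rfl | rfl | rfl | rfl
  · simp [sideBranchTable_inshell]
  · simp [sideBranchTable_up1]
  · simp [sideBranchTable_up2]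
  · simp [sideBranchTable_feed]

/-! ## The diagonal-feed class clause of the repair (KEY-NS #105 (iii)) on the three tables -/

/-- **`α_SB` is a KP network proper**: all its inter-shell feeds are DIAGONAL
(`a ≠ b → α_SB a b i (0,0,1) = 0`), so the side-branch table stays INSIDE the class of the repaired
crux `ForwardSourceTailEnvelope′` — there its forward-source set is `{0, 1}` and the parked pocket
(component `2`) is not counted.  BC8 bookkeeping; MODEL lattice. [this file] -/
theorem sideBranchTable_diagonalFeed :
    ∀ a b i : Fin 4, a ≠ b → sideBranchTable a b i ((0 : ℤ), (0 : ℤ), (1 : ℤ)) = 0 := by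
  intro a b i hab
  rw [sideBranchTable_feed]
  fin_cases a <;> fin_cases b <;> simp at hab ⊢

/-- **`twin-α_SB` is NOT a KP network proper**: its differential feed has the off-diagonal entry
`α_{230,(0,0,1)} = −3/4`, so the class clause of the repair (diagonal inter-shell feeds) EXCLUDES the
witness table — the syntactic check the critic's BC8 probe requires (idea-crit-3 W5).
BC8 bookkeeping; MODEL lattice. [this file] -/
theorem twinSideBranchTable_not_diagonalFeed :
    ¬ (∀ a b i : Fin 4, a ≠ b → twinSideBranchTable a b i ((0 : ℤ), (0 : ℤ), (1 : ℤ)) = 0) := by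
  intro h
  have h23 := h 2 3 0 (by decide)
  rw [twinSideBranchTable_feed] at h23
  simp at h23

/-! ## Honest solutions transfer -/

/-- **`twinEmbed` MAPS HONEST VISCOUS `α_SB`-SOLUTIONS TO HONEST VISCOUS `twin-α_SB`-SOLUTIONS.**
If `X` satisfies the five solution clauses of the crux binders for `sideBranchTable` on `[0, s]`
(one-shell datum `X₀`, no low shells, (4.5)-weighted bound, continuity, exact `ν`-viscous motion as
`HasDerivWithinAt` on `Icc 0 s`), then `twinEmbed X` satisfies them for `twinSideBranchTable` with
datum `twinMix X₀` — for EVERY `ε₀`, `ν`, with no sign or size condition.  MODEL lattice statement.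
[this file] -/
theorem twinEmbed_honest {ε₀ ν s : ℝ} {X₀ : Fin 4 → ℝ} {X : Fin 4 → ℤ → ℝ → ℝ}
    (hinit : ∀ i k, X i k 0 = if k = 0 then X₀ i else 0)
    (hlow : ∀ i k, k < 0 → ∀ t, X i k t = 0)
    (hbd : ∃ M : ℝ, ∀ (t : ℝ) (i : Fin 4) (k : ℤ), (1 + (1 + ε₀) ^ ((10 : ℝ) * k)) * |X i k t| ≤ M)
    (hcont : ∀ i k, Continuous (X i k))
    (hode : ∀ (i : Fin 4) (k : ℤ), ∀ t ∈ Icc (0 : ℝ) s, HasDerivWithinAt (X i k)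
      (quadTerm ε₀ sideBranchTable X i k t - ν * (1 + ε₀) ^ ((2 : ℝ) * k) * X i k t) (Icc 0 s) t) :
    (∀ i k, twinEmbed X i k 0 = if k = 0 then twinMix X₀ i else 0) ∧
    (∀ i k, k < 0 → ∀ t, twinEmbed X i k t = 0) ∧
    (∃ M : ℝ, ∀ (t : ℝ) (i : Fin 4) (k : ℤ),
      (1 + (1 + ε₀) ^ ((10 : ℝ) * k)) * |twinEmbed X i k t| ≤ M) ∧
    (∀ i k, Continuous (twinEmbed X i k)) ∧
    (∀ (i : Fin 4) (k : ℤ), ∀ t ∈ Icc (0 : ℝ) s, HasDerivWithinAt (twinEmbed X i k)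
      (quadTerm ε₀ twinSideBranchTable (twinEmbed X) i k t -
        ν * (1 + ε₀) ^ ((2 : ℝ) * k) * twinEmbed X i k t) (Icc 0 s) t) := by
  have hXt : ∀ i k t, twinEmbed X i k t = ∑ j,
      (![![1, 0, 0, 0], ![0, 1, 0, 0], ![0, 0, 3 / 5, 0], ![0, 0, 4 / 5, 0]] :
        Fin 4 → Fin 4 → ℝ) i j * X j k t := by
    intro i k t
    rw [twinEmbed_eq_matrix]
  have hQ : ∀ (i : Fin 4) (k : ℤ), ∀ t ∈ Icc (0 : ℝ) s,
      quadTerm ε₀ twinSideBranchTable (twinEmbed X) i k t = ∑ j,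
        (![![1, 0, 0, 0], ![0, 1, 0, 0], ![0, 0, 3 / 5, 0], ![0, 0, 4 / 5, 0]] :
          Fin 4 → Fin 4 → ℝ) i j * quadTerm ε₀ sideBranchTable X j k t := by
    intro i k t _
    rw [twinEmbed_eq_matrix, twinSideBranchTable_intertwine]
  exact ⟨redress_init hXt (Xt₀ := twinMix X₀) (fun i => twinMix_eq_matrix X₀ i) hinit,
    redress_noLow hXt hlow, redress_bound hXt hbd, redress_continuous hXt hcont,
    redress_ode hXt hQ hode⟩

/-! ## The reduction: A⁺ as typed ⇒ the A‴ body on the witness table -/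

/-- **`ForwardSourceTailEnvelope` AS TYPED IMPLIES THE TOTAL-ENERGY ENVELOPE A‴ ON `α_SB`.**
Below the threshold `εs = εs(17)` that A⁺ itself provides for the spread `R = 17`, for every scale
ratio `ε₀ ≤ εs`, every one-shell datum `X₀` there is a margin `η > 0` such that for every window `T`
ONE constant `C`, UNIFORM IN `ν > 0`, bounds the TOTAL tail energy
`Σ_{k=n..N} Σ_i ½X_{i,k}(t)² ≤ C(1+ε₀)^{-(1+η)n}` of every honest `ν`-viscous solution of the
side-branch dead-end lattice `sideBranchTable` on `[0, s]`, `s ≤ T` — VERBATIM the body of the aside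
`ViscousTailEnvelope` (stmt-26128) at `α := sideBranchTable`.  Proof: apply A⁺ to
`twinSideBranchTable ∈ E₂(17)`; `twinSideBranchTable_allSource` forces `S = univ`; pull the envelope
back along the exact embedding (`envelope_pullback_of_redress` with `L_SB`, `D = {3}`).
This is the kernel form of the critic's «misstated-CLASS as typed» (idea-crit-3, 2026-08-28
08:35:05Z): the numerics of record report this conclusion FALSE on `α_SB` (parked pocket energy,
exponent `→ 5/9 < 1`), but no certified trajectory bound exists in the tree, so NOTHING is refuted
here.  MODEL lattice statement; not about the Navier–Stokes equations. [this file] -/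
theorem forwardSourceTailEnvelope_imp_totalEnvelope_sideBranch
    (h : SubcriticalEnvelope.ForwardSourceTailEnvelope) :
    ∃ εs : ℝ, 0 < εs ∧ ∀ ε₀ : ℝ, 0 < ε₀ → ε₀ ≤ εs → ∀ X₀ : Fin 4 → ℝ, ∃ η : ℝ, 0 < η ∧
      ∀ T : ℝ, 0 < T → ∃ C : ℝ, ∀ ν : ℝ, 0 < ν → ∀ s ∈ Set.Ioc (0 : ℝ) T,
      ∀ X : Fin 4 → ℤ → ℝ → ℝ,
      (∀ i k, X i k 0 = if k = 0 then X₀ i else 0) →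
      (∀ i k, k < 0 → ∀ t, X i k t = 0) →
      (∃ M : ℝ, ∀ (t : ℝ) (i : Fin 4) (k : ℤ), (1 + (1 + ε₀) ^ ((10 : ℝ) * k)) * |X i k t| ≤ M) →
      (∀ i k, Continuous (X i k)) →
      (∀ i k, ∀ t ∈ Set.Icc (0 : ℝ) s, HasDerivWithinAt (X i k)
        (quadTerm ε₀ sideBranchTable X i k t - ν * (1 + ε₀) ^ ((2 : ℝ) * k) * X i k t)
        (Set.Icc 0 s) t) →
      ∀ n N : ℕ, n ≤ N → ∀ t ∈ Set.Icc (0 : ℝ) s,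
        ∑ k ∈ Finset.Icc n N, ∑ i, (1 / 2) * X i (k : ℤ) t ^ 2 ≤
          C * (1 + ε₀) ^ (-((1 + η) * (n : ℝ))) := by
  obtain ⟨εs, hεs, H⟩ := h 17 (by norm_num)
  refine ⟨εs, hεs, fun ε₀ hε₀ hle X₀ => ?_⟩
  obtain ⟨S, hS, HS⟩ := H ε₀ hε₀ hle twinSideBranchTable twinSideBranchTable_inTableClass
  have hSu : S = Finset.univ := twinSideBranchTable_allSource S hS
  subst hSu
  obtain ⟨η, hη, Hη⟩ := HS (fun i => ∑ j,
    (![![1, 0, 0, 0], ![0, 1, 0, 0], ![0, 0, 3 / 5, 0], ![0, 0, 4 / 5, 0]] :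
      Fin 4 → Fin 4 → ℝ) i j * X₀ j)
  refine ⟨η, hη, fun T hT => ?_⟩
  obtain ⟨C, hC⟩ := Hη T hT
  refine ⟨C + ∑ c ∈ ({3} : Finset (Fin 4)), (1 / 2 : ℝ) * X₀ c ^ 2, fun ν hν s hs => ?_⟩
  exact envelope_pullback_of_redress (by linarith) hν.le
    (![![1, 0, 0, 0], ![0, 1, 0, 0], ![0, 0, 3 / 5, 0], ![0, 0, 4 / 5, 0]] : Fin 4 → Fin 4 → ℝ)
    Finset.univ ({3} : Finset (Fin 4))
    (fun c hc i₁ i₂ μ hμ => by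
      rw [Finset.mem_singleton] at hc
      subst hc
      exact sideBranchTable_target_three i₁ i₂ μ hμ)
    (twinSideBranchTable_intertwine ε₀) twinMix_energy_le X₀ (hC ν hν s hs)

end Summit.NavierStokesRegularity.NavierStokesRegularity.Theorems

end
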